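import Mathlib
import Summits.RiemannHypothesis.RiemannHypothesis.Theorems.WeilFormatCSoundness
import HarnessLib

/-!
# Format C: the BANDED far minorant (design "BF") — certified per-mode weights on a band replace the uniform far diagonal

Route context: Fourier–Galerkin / Schur-complement certificates of Weil positivity on a window ("format C";
cell memo `run/shared/lean/pub/rh-explicit/rh-explicit-weil-10/FORMATC-DESIGN.md` §9.11; supporting
stmt-RiemannHypothesis-0098; seat rh-explicit-weil-10; the data-lane twin is rh-explicit-weil-6's `TAILFLOOR.md` §4).

The two-level certificate (`WeilFormatCSoundness`) bounds the far block `(M(n,m))_{n,m ≥ B}` from below by a DIAGONAL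
`diag(d̂)` whose entries carry the window-uniform prime constant `−A/2` (and, in the odd sector, the Hilbert penalty):
`Σ_{n≥B} d̂_n y_n² ≤ Σ_{n,m≥B} y_n M(n,m) y_m`.  The measured cost driver of a kernel rung is the block size `B`, and
`B` is set by how much this diagonal under-states the far block (weil-10 gen6, kit j173055: at `a = 1` the Schur loss
computed with `d̂` is `1.3–3.5×` the true loss, with the TRUE diagonal it is `≈ 1.0×`).

This file proves the generic upgrade: on a BAND `[B, B + b)` the far weights may be ANY positive reals `θ_n`, provided
ONE finite certificate holds — the band block minus `diag θ` minus `ρ⁻¹×`(a majorant of the band-to-far coupling through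
the old diagonal `d̂` beyond the band) is positive semidefinite — and beyond the band the old diagonal is kept with the
factor `(1 − ρ)`:

* `far_minorant_banded` — for a symmetric kernel `M`, a band `[B, B+b)`, weights `θ > 0` on the band, the old far
  diagonal `dfar > 0` with its far inequality from `B + b` on, a split majorant `U₁ + U₂` of
  `Σ_{m ≥ B+b} (Σ_{j<b} M(B+j, m) z_j)²/dfar(m)` (exact band columns on `[B+b, B+b₃)`, structured tail beyond) and the
  band certificate `0 ≤ Σ_{j,j'} z_j z_j' (M(B+j,B+j') − δ_{jj'}θ_{B+j} − ρ⁻¹U₁ − ρ⁻¹U₂)`, one gets for EVERY truncation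
  `Σ_{B≤n<N} dθ(n) y_n² ≤ Σ_{B≤n,m<N} y_n M(n,m) y_m` with `dθ(n) = θ_n` on the band and `(1−ρ)·dfar(n)` beyond —
  i.e. exactly the hypothesis `hfar` of `sum_range_mul_mul_nonneg_of_certificate_sum_split` with the better weights.

Proof: the statement says that the kernel `K(i,j) = M(B+i,B+j) − δ_{ij} dθ(B+i)` is positive semidefinite on every
truncation, and THAT is the two-level soundness theorem `sum_range_mul_mul_nonneg_of_certificate_sum_split` applied to
`K` with block `b`, far diagonal `ρ·dfar(B+·)` and majorants `ρ⁻¹U₁`, `ρ⁻¹U₂` (its far inequality is the old one: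
`ρ·dfar + (1−ρ)·dfar = dfar`).  Pure finite-dimensional real algebra; standard axioms; nothing Weil-specific; no RH claim.
-/

-- `Summit.RiemannHypothesis.RiemannHypothesis.…` is the layout-mandated namespace (summit = problem name).
set_option linter.dupNamespace false

namespace Summit.RiemannHypothesis.RiemannHypothesis.Theorems.WeilFormatC

open Matrix Finset

/-! ## Index bookkeeping: shifting `Ico` sums by the block size -/

/-- `Σ_{n ∈ [B+b, B+N)} f(n) = Σ_{k ∈ [b, N)} f(B+k)`. -/
theorem sum_Ico_add_shift (f : ℕ → ℝ) (B b N : ℕ) :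
    ∑ n ∈ Ico (B + b) (B + N), f n = ∑ k ∈ Ico b N, f (B + k) := by
  rw [Finset.sum_Ico_eq_sum_range, Finset.sum_Ico_eq_sum_range, Nat.add_sub_add_left]
  exact Finset.sum_congr rfl fun k _ ↦ by rw [add_assoc]

/-- `Σ_{n ∈ [B, B+N)} f(n) = Σ_{k < N} f(B+k)`. -/
theorem sum_Ico_shift_range (f : ℕ → ℝ) (B N : ℕ) :
    ∑ n ∈ Ico B (B + N), f n = ∑ k ∈ range N, f (B + k) := by
  rw [Finset.sum_Ico_eq_sum_range, Nat.add_sub_cancel_left]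

/-- Double-sum version of `sum_Ico_add_shift`. -/
theorem sum_Ico_Ico_add_shift (F : ℕ → ℕ → ℝ) (B b N : ℕ) :
    ∑ n ∈ Ico (B + b) (B + N), ∑ m ∈ Ico (B + b) (B + N), F n m
      = ∑ i ∈ Ico b N, ∑ j ∈ Ico b N, F (B + i) (B + j) := by
  rw [sum_Ico_add_shift _ B b N]
  exact Finset.sum_congr rfl fun i _ ↦ sum_Ico_add_shift _ B b N

/-- Double-sum version of `sum_Ico_shift_range`. -/
theorem sum_Ico_Ico_shift_range (F : ℕ → ℕ → ℝ) (B N : ℕ) :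
    ∑ n ∈ Ico B (B + N), ∑ m ∈ Ico B (B + N), F n m
      = ∑ i ∈ range N, ∑ j ∈ range N, F (B + i) (B + j) := by
  rw [sum_Ico_shift_range _ B N]
  exact Finset.sum_congr rfl fun i _ ↦ sum_Ico_shift_range _ B N

/-! ## The banded far minorant -/

/-- **Banded far minorant (design "BF").**  `M` symmetric; block `B`, band `[B, B+b)`, exact band-column range
`[B+b, B+b₃)`; band weights `θ` (any reals — positivity is not needed for this inequality, the rung door asks for it
separately); old far diagonal `dfar`, positive from `B+b` on, with its far inequality `hfarM` from `B+b` on; `0 < ρ`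
(the door takes `ρ < 1`); `U₁`/`U₂` majorise the band-to-far coupling through `dfar` (exact columns on
`[B+b, B+b₃)`, tail from `B+b₃`), and the BAND CERTIFICATE `hSd` holds.  Then the far inequality holds from `B` on with
the weights `θ` on the band and `(1−ρ)·dfar` beyond. -/
theorem far_minorant_banded (M : ℕ → ℕ → ℝ) (hsymm : ∀ n m, M n m = M m n)
    (B b b₃ : ℕ) (hb : b ≤ b₃) (θ dfar : ℕ → ℝ) {ρ : ℝ} (hρ0 : 0 < ρ)
    (hdfar : ∀ n, B + b ≤ n → 0 < dfar n)
    (hfarM : ∀ (N : ℕ) (y : ℕ → ℝ),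
      ∑ n ∈ Ico (B + b) N, dfar n * y n ^ 2 ≤ ∑ n ∈ Ico (B + b) N, ∑ m ∈ Ico (B + b) N, y n * M n m * y m)
    (U₁ U₂ : Matrix (Fin b) (Fin b) ℝ)
    (hU₁ : ∀ z : Fin b → ℝ,
      ∑ m ∈ Ico (B + b) (B + b₃), (∑ j : Fin b, M (B + j) m * z j) ^ 2 / dfar m ≤ z ⬝ᵥ U₁ *ᵥ z)
    (hU₂ : ∀ (N : ℕ) (z : Fin b → ℝ),
      ∑ m ∈ Ico (B + b₃) N, (∑ j : Fin b, M (B + j) m * z j) ^ 2 / dfar m ≤ z ⬝ᵥ U₂ *ᵥ z)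
    (hSd : ∀ z : Fin b → ℝ, 0 ≤ ∑ j, ∑ j', z j * z j' *
      (M (B + j) (B + j') - (if (j : ℕ) = (j' : ℕ) then θ (B + j) else 0) - ρ⁻¹ * U₁ j j' - ρ⁻¹ * U₂ j j'))
    (N : ℕ) (y : ℕ → ℝ) :
    ∑ n ∈ Ico B N, (if n < B + b then θ n else (1 - ρ) * dfar n) * y n ^ 2
      ≤ ∑ n ∈ Ico B N, ∑ m ∈ Ico B N, y n * M n m * y m := by
  -- diagonal extraction `Σ_{i,j∈s} z_i·(δ_{ij} d_i)·z_j = Σ_{i∈s} d_i z_i²` (kept local)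
  have diag_extract : ∀ (s : Finset ℕ) (d z : ℕ → ℝ),
      ∑ i ∈ s, ∑ j ∈ s, z i * (if i = j then d i else 0) * z j = ∑ i ∈ s, d i * z i ^ 2 := by
    intro s d z
    refine Finset.sum_congr rfl fun i hi ↦ ?_
    have h : ∀ j ∈ s, z i * (if i = j then d i else 0) * z j = if i = j then d i * z i ^ 2 else 0 := by
      intro j _
      by_cases hij : i = j
      · subst hij; simp only [if_true]; ring
      · simp only [if_neg hij, mul_zero, zero_mul]
    rw [Finset.sum_congr rfl h, Finset.sum_ite_eq, if_pos hi]
  -- the modified, shifted kernel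
  set dθ : ℕ → ℝ := fun n ↦ if n < B + b then θ n else (1 - ρ) * dfar n with hdθ
  set K : ℕ → ℕ → ℝ := fun i j ↦ M (B + i) (B + j) - if i = j then dθ (B + i) else 0 with hK
  have hKsymm : ∀ i j, K i j = K j i := by
    intro i j
    simp only [hK]
    by_cases hij : i = j
    · subst hij; rfl
    · rw [if_neg hij, if_neg (Ne.symm hij), hsymm]
  -- off-diagonal entries of `K` are those of `M`
  have hKoff : ∀ (i : Fin b) (m : ℕ), b ≤ m → K i m = M (B + i) (B + m) := by
    intro i m hm
    have hne : (i : ℕ) ≠ m := by have := i.isLt; omega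
    simp only [hK, if_neg hne, sub_zero]
  have hcol : ∀ (z : Fin b → ℝ) (m : ℕ), b ≤ m →
      (∑ i : Fin b, K i m * z i) = ∑ j : Fin b, M (B + j) (B + m) * z j := by
    intro z m hm
    exact Finset.sum_congr rfl fun i _ ↦ by rw [hKoff i m hm]
  -- (hd) positivity of the new far diagonal `ρ·dfar(B+·)` beyond the band
  have hd : ∀ m, b ≤ m → 0 < ρ * dfar (B + m) := fun m hm ↦ mul_pos hρ0 (hdfar _ (by omega))
  -- (hfar) for `K`: the old far inequality, shifted
  have hfarK : ∀ (N' : ℕ) (w : ℕ → ℝ),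
      ∑ n ∈ Ico b N', ρ * dfar (B + n) * w n ^ 2 ≤ ∑ n ∈ Ico b N', ∑ m ∈ Ico b N', w n * K n m * w m := by
    intro N' w
    -- shift the old inequality to `[b, N')` with `y n := w (n - B)`
    have old := hfarM (B + N') (fun n ↦ w (n - B))
    rw [sum_Ico_add_shift _ B b N', sum_Ico_Ico_add_shift _ B b N'] at old
    simp only [Nat.add_sub_cancel_left] at old
    -- split `K` into `M` and the diagonal `dθ = (1-ρ) dfar` there
    have hsplit : ∑ n ∈ Ico b N', ∑ m ∈ Ico b N', w n * K n m * w m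
        = ∑ n ∈ Ico b N', ∑ m ∈ Ico b N', w n * M (B + n) (B + m) * w m
          - ∑ n ∈ Ico b N', (1 - ρ) * dfar (B + n) * w n ^ 2 := by
      have e1 : ∑ n ∈ Ico b N', ∑ m ∈ Ico b N', w n * K n m * w m
          = ∑ n ∈ Ico b N', ∑ m ∈ Ico b N', (w n * M (B + n) (B + m) * w m
              - w n * (if n = m then dθ (B + n) else 0) * w m) :=
        Finset.sum_congr rfl fun n _ ↦ Finset.sum_congr rfl fun m _ ↦ by simp only [hK]; ring
      rw [e1]
      simp only [Finset.sum_sub_distrib]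
      rw [diag_extract (Ico b N') (fun n ↦ dθ (B + n)) w]
      congr 1
      refine Finset.sum_congr rfl fun n hn ↦ ?_
      have hn' : ¬ (B + n < B + b) := by have := (Finset.mem_Ico.mp hn).1; omega
      simp only [hdθ, if_neg hn']
    rw [hsplit]
    have e2 : ∑ n ∈ Ico b N', ρ * dfar (B + n) * w n ^ 2 + ∑ n ∈ Ico b N', (1 - ρ) * dfar (B + n) * w n ^ 2
        = ∑ n ∈ Ico b N', dfar (B + n) * w n ^ 2 := by
      rw [← Finset.sum_add_distrib]
      exact Finset.sum_congr rfl fun n _ ↦ by ring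
    linarith [old, e2]
  -- (hU₁) for `K`
  have hU₁K : ∀ x : Fin b → ℝ,
      ∑ m ∈ Ico b b₃, (∑ i : Fin b, K i m * x i) ^ 2 / (ρ * dfar (B + m)) ≤ x ⬝ᵥ (ρ⁻¹ • U₁) *ᵥ x := by
    intro x
    have h1 := hU₁ x
    rw [sum_Ico_add_shift _ B b b₃] at h1
    have e : ∑ m ∈ Ico b b₃, (∑ i : Fin b, K i m * x i) ^ 2 / (ρ * dfar (B + m))
        = ρ⁻¹ * ∑ m ∈ Ico b b₃, (∑ j : Fin b, M (B + j) (B + m) * x j) ^ 2 / dfar (B + m) := by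
      rw [Finset.mul_sum]
      refine Finset.sum_congr rfl fun m hm ↦ ?_
      rw [hcol x m (Finset.mem_Ico.mp hm).1]
      field_simp
    rw [e, Matrix.smul_mulVec, dotProduct_smul, smul_eq_mul]
    exact mul_le_mul_of_nonneg_left h1 (inv_pos.mpr hρ0).le
  -- (hU₂) for `K`
  have hU₂K : ∀ (N' : ℕ) (x : Fin b → ℝ),
      ∑ m ∈ Ico b₃ N', (∑ i : Fin b, K i m * x i) ^ 2 / (ρ * dfar (B + m)) ≤ x ⬝ᵥ (ρ⁻¹ • U₂) *ᵥ x := by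
    intro N' x
    by_cases hN' : b₃ ≤ N'
    · have h2 := hU₂ (B + N') x
      rw [sum_Ico_add_shift _ B b₃ N'] at h2
      have e : ∑ m ∈ Ico b₃ N', (∑ i : Fin b, K i m * x i) ^ 2 / (ρ * dfar (B + m))
          = ρ⁻¹ * ∑ m ∈ Ico b₃ N', (∑ j : Fin b, M (B + j) (B + m) * x j) ^ 2 / dfar (B + m) := by
        rw [Finset.mul_sum]
        refine Finset.sum_congr rfl fun m hm ↦ ?_
        rw [hcol x m (le_trans hb (Finset.mem_Ico.mp hm).1)]
        field_simp
      rw [e, Matrix.smul_mulVec, dotProduct_smul, smul_eq_mul]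
      exact mul_le_mul_of_nonneg_left h2 (inv_pos.mpr hρ0).le
    · -- empty range; the right side is non-negative by `hU₂` at `N = B + b₃`
      have hN'' : N' ≤ b₃ := le_of_not_ge hN'
      rw [Finset.Ico_eq_empty_of_le hN'', Finset.sum_empty]
      have h2 := hU₂ (B + b₃) x
      rw [Finset.Ico_self, Finset.sum_empty] at h2
      rw [Matrix.smul_mulVec, dotProduct_smul, smul_eq_mul]
      exact mul_nonneg (inv_pos.mpr hρ0).le h2
  -- (hS) for `K`
  have hSK : ∀ x : Fin b → ℝ, 0 ≤ ∑ i, ∑ j, x i * x j * (K i j - (ρ⁻¹ • U₁) i j - (ρ⁻¹ • U₂) i j) := by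
    intro x
    refine (hSd x).trans_eq (Finset.sum_congr rfl fun i _ ↦ Finset.sum_congr rfl fun j _ ↦ ?_)
    have hi : B + (i : ℕ) < B + b := by have := i.isLt; omega
    simp only [hK, hdθ, Matrix.smul_apply, smul_eq_mul, if_pos hi, Fin.val_eq_val]
  -- apply the two-level soundness theorem to `K`
  have key := sum_range_mul_mul_nonneg_of_certificate_sum_split K hKsymm b b₃ hb
    (fun m ↦ ρ * dfar (B + m)) (ρ⁻¹ • U₁) (ρ⁻¹ • U₂) hd hfarK hU₁K hU₂K hSK
  -- conclude: the PSD statement for `K` on `range N'` is the claim on `Ico B (B + N')`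
  rcases le_or_gt B N with hBN | hNB
  · obtain ⟨N', rfl⟩ := Nat.exists_eq_add_of_le hBN
    have h0 := key N' (fun k ↦ y (B + k))
    rw [sum_Ico_shift_range _ B N', sum_Ico_Ico_shift_range _ B N']
    have e : ∑ i ∈ range N', ∑ j ∈ range N', y (B + i) * y (B + j) * K i j
        = ∑ i ∈ range N', ∑ j ∈ range N', y (B + i) * M (B + i) (B + j) * y (B + j)
          - ∑ i ∈ range N', dθ (B + i) * y (B + i) ^ 2 := by
      have e1 : ∑ i ∈ range N', ∑ j ∈ range N', y (B + i) * y (B + j) * K i j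
          = ∑ i ∈ range N', ∑ j ∈ range N', (y (B + i) * M (B + i) (B + j) * y (B + j)
              - y (B + i) * (if i = j then dθ (B + i) else 0) * y (B + j)) :=
        Finset.sum_congr rfl fun i _ ↦ Finset.sum_congr rfl fun j _ ↦ by simp only [hK]; ring
      rw [e1]
      simp only [Finset.sum_sub_distrib]
      rw [diag_extract (range N') (fun i ↦ dθ (B + i)) (fun i ↦ y (B + i))]
    rw [e] at h0
    have e3 : ∑ k ∈ range N', (if B + k < B + b then θ (B + k) else (1 - ρ) * dfar (B + k)) * y (B + k) ^ 2
        = ∑ i ∈ range N', dθ (B + i) * y (B + i) ^ 2 :=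
      Finset.sum_congr rfl fun k _ ↦ by simp only [hdθ]
    rw [e3]
    linarith [h0]
  · rw [Finset.Ico_eq_empty_of_le hNB.le]
    simp

end Summit.RiemannHypothesis.RiemannHypothesis.Theorems.WeilFormatC
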